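import Summits.BirchSwinnertonDyer.Rank1Residual.Additive.QuadraticBranchSignedMainConjecture
import Summits.BirchSwinnertonDyer.Rank1Residual.Additive.StrictSignedSelmer
import HarnessLib

/-!
# RANK ZERO on the quadratic branch: the EVEN exact control of Kobayashi's plus Selmer group at the
# bottom layer `n = 0` — B.D. Kim's Euler-characteristic formula on the component `η = ω^{(p−1)/2}` —
# TYPED (T-e2-r0), with its two READINGS; NOTHING ASSERTED (cell `bsd-potss`, seat `bsd-potss-ctrl`
# g2; `HOME/TARGET.md` v2 §1.1 "STATEMENT TO TYPE"; the even twin of cc-typer-6's p307042 (C3_η)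
# `QuadraticBranchOddStrictExactControlOfPlusMCAt` and of x1b's readings file
# `QuadraticBranchOddStrictSelmerReadings.lean`)

HONEST FRAMING (cell `bsd-potss`, run/shared/lean/pub/bsd-potss/; FULL-BSD rank ≤ 1 programme,
tranche 1b, HUMAN RULING D-0036): the target of record is FULL BSD for every analytic-rank ≤ 1 curve
over `ℚ`; this cell attacks rows B4/B5/B8 (additive potentially supersingular primes). THIS FILE types
ONE theorem-shaped statement and TWO readings of printed statements as `@[conjecture] def`s —
TYPED INPUTS, nothing asserted, no named Literature fact minted, no `sorry`, axioms standard; the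
class served (Gss2 = O5 ∩ `e = 2`: `W = V ⊗ χ_{p*}`, `V` good supersingular with `a_p(V) = 0`, in
analytic rank ZERO; and the CM rows O10-PS of cell `bsd-cm`) stays OPEN; (C1_η)
`QuadraticBranchPlusMainConjectureAt` stays a CONJECTURE IN PRINT; nothing is booked; no label /
mark / count moves. The DISCHARGE of (T-e2-r0) from the two readings + Poitou–Tate is the seat's
proof series (`QuadraticBranchEvenControlZero.lean` = file 1, landed as p401824, and sequels).

## The frame (TARGET.md v2 §1.1; Kobayashi 2003 §9; B. D. Kim 2013)

`p` odd, `p* = (−1)^{(p−1)/2} p`, `η = χ_{p*} = ω^{(p−1)/2}`, `W/ℚ` globally minimal with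
`C • W^{(p*)} = V`, `V` globally minimal with good reduction at `p` and `a_p(V) = 0` (so `W = V ⊗ η`
has additive, potentially supersingular reduction of Kodaira type `I₀*` at `p`). On the `η`-component
Kobayashi's PLUS condition imposes NOTHING at the bottom layer (Def. 1.1/2.1: "`Tr_{n/m+1} P ∈
E(k_m)` for even `m`, `0 ≤ m < n`" is empty at `n = 0`; tree `signedLocalPointsOfEmb_zero`,
`strictSignedLocalPointsOfEmb_one`), so `Sel⁺(V/ℚ(μ_p))^η = Sel_{p^∞}(W/ℚ)` — in the tree's
`W`-coordinates `#Sel⁺(W/ℚ_0) = #Sel_{p^∞}(W/ℚ)`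
(`StrictSignedLayerZero.natCard_strictSignedSelmerLayer_one_zero_eq_selmerGroupPInfty`, file 1) —
while the MINUS condition's `η`-part is the STRICT group (the rank-one object of (C3_η)). The
control theorem Thm. 9.3 at `n = 0` (Greenberg's argument, LNM 1716 §3–§4) compares
`Sel_{p^∞}(W/ℚ)` with `X⁺ = Sel⁺(W/ℚ_∞)^∨`: its local kernel at `ℓ ≠ p` is Greenberg's Lemma 3.3
group of order `c_ℓ(W)^{(p)}`, and its local kernel AT `p` is ZERO by (9.33) (Prop. 9.2 dualised:
the level-`∞` plus Kummer condition pulls back to the classical Kummer condition at the bottom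
layer). With `X⁺` torsion, `char X⁺ = (f)`, `f(0) ≠ 0` and NO finite `Λ`-submodule (Kitajima–Otsuki
2018 Main Thm. 1.3, sign `+`), Greenberg's Lemma 4.2 gives B. D. Kim's formula (J. Aust. Math. Soc.
95 (2013), Thm. 1.1 — printed for good supersingular `E/ℚ` on the trivial component; here READ on
the `η`-component): **`ord_p #Sel_{p^∞}(W/ℚ) + ∑_{ℓ ≠ p} ord_p c_ℓ(W) − 2 ord_p #W(ℚ)_tors =
ord_p f(0)`**, where `#W(ℚ)[p] = 1` and `p ∤ c_p(W) ∈ {1,2,4}` (`I₀*`, `p ≥ 5`) make the left side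
`ord_p #Sel_{p^∞}(W/ℚ) + ord_p(Tam(W)/#W(ℚ)_tors²)`. Reading the even main conjecture (C1_η) on `X⁺`
(`f = L_p⁺(V, η, X)` up to `ℤ_p^×`; existence of `L_p⁺(V, η, X)` is the tree theorem
`exists_isQuadraticBranchPlusLFunction_of_isNewformOf`, p401121, its non-vanishing
`IsQuadraticBranchPlusLFunction.ne_zero_of_isNewformOf`, p401122) gives (T-e2-r0). Its VALUE side
— `L_p⁺(V, η, 0) = −(p/τ(η)) L(V, η̄, 1)/Ω_V^δ` (Kobayashi (3.6); tree
`IsQuadraticBranchPlusLFunction.constantCoeff`) `= unit · ϖ · ∑_{a mod p} (a/p)[a/p]^δ_f` and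
`L(W, 1) = ϖ · (∑ (a/p)[a/p]^δ_f) · Ω_W (/c_∞)` (Birch × Pal, tree
`entireLFunction_one_eq_of_twist_pos` / `_neg_signed`) — is what turns (T-e2-r0) into `BSD(W, p)` in
analytic rank `0` (the consumer is a sequel file; no heights, no Gross–Zagier, no (C2_η)/(C3_η)).

## Contents

* §1 (R1⁺) `EvenBranchPlusCharIdealOfPlusMCAt W p` — READING of (C1_η) on the `W`-coordinate plus
  dual data: `Char X⁺(W/ℚ_∞) = (L_p⁺(V, η, X))` (flags `Kob03-MC-eta-quadratic-subtower`,
  `plus-eta-twist-reading`).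
* §2 (R2⁺) `EvenBranchPlusNoFiniteSubmoduleAt W p` — READING of Kitajima–Otsuki Main Thm. 1.3,
  sign `+` (flag `KO18-plus-eta-twist-reading`); the even twin of x1b's (R2).
* §3 (T-e2-r0) `QuadraticBranchEvenExactControlOfPlusMCAt W p` — the typed TARGET.
* §4 bookkeeping lemmas (the target at a pair gives finiteness of `Sel_{p^∞}(W/ℚ)`; its unit case).

References: [Kobayashi2003] Def. 1.1 (p. 2), Def. 2.1, Thm. 2.2 (p. 5), Thm. 3.2 + (3.6) (p. 7), §4
(p. 8), Thm. 7.4 (p. 13), Lemma 9.1, Prop. 9.2, Thm. 9.3 with (9.33) (pp. 25–27);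
[GreenbergLNM1716] §3 Lemma 3.3, §4 Thm. 4.1, Lemma 4.2 (p. 102); [KitajimaOtsuki2018] Main Thm. 1.3
(= Thm. 4.8) with Def. 2.1 (arXiv:1607.03612 pp. 3, 6); B. D. Kim, J. Aust. Math. Soc. 95 (2013)
189–200, Thm. 1.1 (shape of the target formula); [PollackRubin2004] p. 448 (CM remark).
-/

noncomputable section

open scoped Classical MatrixGroups ModularForm

open CongruenceSubgroup WeierstrassCurve Literature.NumberTheory.EllipticCurves
  Literature.NumberTheory.EllipticCurves.ModularForms
  Literature.NumberTheory.EllipticCurves.Kobayashi2003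
  Literature.NumberTheory.EllipticCurves.Rank1Residual
  Literature.NumberTheory.GaloisRepresentations ZpExtension

namespace Summit.BirchSwinnertonDyer.Rank1Residual.Additive

/-! ## §1 (R1⁺) — (C1_η) READ on the plus dual data of `W` over `ℚ_∞` -/

/-- **TYPED INPUT (R1⁺) — READING of Kobayashi's EVEN main conjecture at `η` ((C1_η), a CONJECTURE
IN PRINT, typed as `QuadraticBranchPlusMainConjectureAt V p` over `ℚ(√p*)`) on the tree's
`W`-coordinate plus dual data; flags `Kob03-MC-eta-quadratic-subtower`, `plus-eta-twist-reading`;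
NOTHING asserted.** For `W/ℚ` globally minimal, `p` odd, `V` a globally minimal model of the twist
`W^{(p*)}` (`C • W.quadraticTwist ((−1)^{p/2} p) = V`) with good reduction at `p` and `a_p(V) = 0`,
its newform `f`, the period ratio `ϖ` of the parity of `η`, ANY `Lη` with the interpolation
property of `L_p⁺(V, η, X)` (`IsQuadraticBranchPlusLFunction`; exists by
`exists_isQuadraticBranchPlusLFunction_of_isNewformOf`, unique up to `ℤ_p^×`), the cyclotomic
`ℤ_p`-extension `κ` with a topological generator `γ` matching the variable (`IsCyclotomicVariable`),
and ANY Pontryagin-dual datum `D` of the PLUS Selmer group `Sel⁺(W/ℚ_∞)` in `W`-coordinates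
(`StrictSignedSelmerDualData W κ ℚ_[p] γ 1`; Def. 2.1 has no extra clause on the even side): IF
(C1_η) holds for `V` at `p` THEN `X⁺` is finitely generated `Λ`-torsion and
**`Char X⁺(W/ℚ_∞) = (Lη)`**. The reading: `X⁺(W/ℚ_∞) = X⁺(V/ℚ(μ_{p^∞}))^η` (the plus condition for
`V` over `k_n = ℚ_p(ζ_{p^{n+1}})` restricted to the `η`-odd points = the plus condition for `W` over
`ℚ_{n,p}`: the traces commute with the twist transport, cf. x1b's minus dictionary
`SignedTwistTraceDictionary` / `SignedTwistDualTransport`), and (C1_η) as typed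
(`Char X⁺(V/F_∞) = Char X⁺(V/ℚ_∞)·(Lη)`, `F = ℚ(√p*)`) is the `η`-part statement
`Char X⁺(V/K_∞)^η = (Lη)` by prime-to-`p` descent (`X⁺(V/F_∞) ≅ X⁺(V/ℚ_∞) ⊕ X⁺(V/K_∞)^η`, Thm. 2.2
for `X⁺(V/ℚ_∞)` torsion, `Λ` a domain). [cite: Kobayashi2003, §4 (p. 8), Thm. 2.2 (p. 5), Def. 2.1 (p. 5), §3 (p. 5)]
[cite: GreenbergLNM1716, §3 (prime-to-p descent of Selmer groups; reading)]
[cite: PollackRubin2004, Theorem and the remark on Sel over ℚ(μ_{p^∞}) (p. 448)] -/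
@[conjecture] def EvenBranchPlusCharIdealOfPlusMCAt (W : WeierstrassCurve ℚ) [W.IsElliptic]
    [W.IsGloballyMinimal] (p : ℕ) [Fact p.Prime] : Prop :=
  ∀ (V : WeierstrassCurve ℚ) [V.IsElliptic] [V.IsGloballyMinimal] (C : VariableChange ℚ)
    {N : ℕ} [NeZero N] {f : CuspForm (Gamma0 N) 2},
    p ≠ 2 → C • W.quadraticTwist ((-1) ^ (p / 2) * p) = V →
    V.HasGoodReductionAtPrime p → V.frobeniusTrace p = 0 →
    QuadraticBranchPlusMainConjectureAt V p →
    IsNewformOf V f →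
    ∀ (ϖ : ℚ), (if Even (p / 2) then (ϖ : ℝ) * V.realPeriodRat = plusPeriod f
        else (ϖ : ℝ) * V.imaginaryPeriodRat = minusPeriod f) →
    ∀ (Lη : IwasawaAlgebra p), IsQuadraticBranchPlusLFunction f p ϖ Lη →
    ∀ (κ : ZpExtension ℚ p) (γ : Field.absoluteGaloisGroup ℚ),
      κ.IsCyclotomic → κ.IsTopGenerator γ → IsCyclotomicVariable p γ →
    ∀ (D : StrictSignedSelmerDualData W κ ℚ_[p] γ 1),
      Module.Finite (IwasawaAlgebra p) D.X ∧ Module.IsTorsion (IwasawaAlgebra p) D.X ∧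
        D.charIdeal = Ideal.span {Lη}

/-! ## §2 (R2⁺) — Kitajima–Otsuki, sign `+`, READ on the plus dual data of `W` -/

/-- **TYPED INPUT (R2⁺) — READING of Kitajima–Otsuki 2018 Main Thm. 1.3 (sign `+`, `F_0 = ℚ(μ_p)`,
`a_p = 0`) through the `η`-twist dictionary; flag `KO18-plus-eta-twist-reading`; NOTHING asserted.**
For `W`, `p`, `V`, `C` as in (R1⁺) (no newform needed), the cyclotomic `κ` and any topological
generator `γ`: every Pontryagin-dual datum of the PLUS Selmer group of `W` over `ℚ_∞` (model `ℚ_[p]`)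
whose module is finitely generated and `Λ`-torsion (the printed hypothesis (vi), displayed) has NO
non-trivial finite `Λ`-submodule ("both `Sel^±(F_∞, E[p^∞])^∨` have no nontrivial finite
`Λ`-submodule"; an `η`-part inherits the property). The even twin of x1b's (R2)
`OddBranchStrictMinusNoFiniteSubmoduleAt`.
[cite: KitajimaOtsuki2018, Main Thm. 1.3 (= Thm. 4.8) with Def. 2.1 (arXiv:1607.03612 pp. 3, 6)]
[cite: Kobayashi2003, Def. 2.1 and Thm. 2.2 (p. 5)] -/
@[conjecture] def EvenBranchPlusNoFiniteSubmoduleAt (W : WeierstrassCurve ℚ) [W.IsElliptic]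
    [W.IsGloballyMinimal] (p : ℕ) [Fact p.Prime] : Prop :=
  ∀ (V : WeierstrassCurve ℚ) [V.IsElliptic] [V.IsGloballyMinimal] (C : VariableChange ℚ),
    p ≠ 2 → C • W.quadraticTwist ((-1) ^ (p / 2) * p) = V →
    V.HasGoodReductionAtPrime p → V.frobeniusTrace p = 0 →
    ∀ (κ : ZpExtension ℚ p) (γ : Field.absoluteGaloisGroup ℚ),
      κ.IsCyclotomic → κ.IsTopGenerator γ →
    ∀ (D : StrictSignedSelmerDualData W κ ℚ_[p] γ 1),
      Module.Finite (IwasawaAlgebra p) D.X → Module.IsTorsion (IwasawaAlgebra p) D.X →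
      ∀ (M : Submodule (IwasawaAlgebra p) D.X), Finite M → M = ⊥

/-! ## §3 (T-e2-r0) — the EVEN exact control at the bottom layer (B. D. Kim's formula at `η`) -/

/-- **TYPED TARGET (T-e2-r0) — the rank-ZERO twin of (C3_η): EXACT control of the plus Selmer group
on the quadratic branch at the bottom layer `n = 0`; CONJECTURE-LEVEL only through (C1_η); the cell's
proof series discharges it from (R1⁺) + (R2⁺) + Poitou–Tate; NOTHING asserted here.** For `W/ℚ`
globally minimal, `p ≥ 5`, `V` a globally minimal model of `W^{(p*)}` (`C • W.quadraticTwist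
((−1)^{p/2} p) = V`) with good reduction at `p` and `a_p(V) = 0`, ASSUMING (C1_η) for `V` at `p`, for
the newform `f` of `V`, the period ratio `ϖ` of the parity of `η` and ANY `L` with the interpolation
property of `L_p⁺(V, η, X)` whose constant term `L(0) = L_p⁺(V, η, 0)` is non-zero (automatic in
analytic rank `0` by (3.6) + Birch + `L(W,1) ≠ 0`): **`Sel_{p^∞}(W/ℚ)` is finite and
`ord_p #Sel_{p^∞}(W/ℚ) + ord_p(Tam(W)/#W(ℚ)_tors²) = v_p(L(0))`** — B. D. Kim's formula
"`#Sel(E/ℚ)[p^∞] · ∏ c_ℓ / #E(ℚ)(p)² ~ f^±(0)`" READ on the component `η` of `Sel⁺(V/ℚ(μ_{p^∞}))`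
(`= Sel_{p^∞}(W/ℚ)` at the bottom, no term at `p` by Kobayashi's (9.33), `p ∤ c_p(W) ∈ {1,2,4}`,
`#W(ℚ)[p] = 1`). STATUS: typed input; its antecedent (C1_η) is OPEN for non-CM `V`; nothing booked.
[cite: Kobayashi2003, Thm. 9.3 with (9.33) (p. 26), Prop. 9.2, Lemma 9.1 (p. 25), (3.6) (p. 7), §4 (p. 8)]
[cite: GreenbergLNM1716, §3 Lemma 3.3 and §4 Thm. 4.1, Lemma 4.2 (p. 102)]
[cite: KitajimaOtsuki2018, Main Thm. 1.3 (arXiv:1607.03612 p. 3)] -/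
@[conjecture] def QuadraticBranchEvenExactControlOfPlusMCAt (W : WeierstrassCurve ℚ)
    [W.IsElliptic] [W.IsGloballyMinimal] (p : ℕ) [Fact p.Prime] : Prop :=
  ∀ (V : WeierstrassCurve ℚ) [V.IsElliptic] [V.IsGloballyMinimal] (C : VariableChange ℚ)
    {N : ℕ} [NeZero N] {f : CuspForm (Gamma0 N) 2},
    5 ≤ p → C • W.quadraticTwist ((-1) ^ (p / 2) * p) = V →
    V.HasGoodReductionAtPrime p → V.frobeniusTrace p = 0 →
    QuadraticBranchPlusMainConjectureAt V p →
    IsNewformOf V f →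
    ∀ (ϖ : ℚ), (if Even (p / 2) then (ϖ : ℝ) * V.realPeriodRat = plusPeriod f
        else (ϖ : ℝ) * V.imaginaryPeriodRat = minusPeriod f) →
    ∀ (L : IwasawaAlgebra p), IsQuadraticBranchPlusLFunction f p ϖ L →
    PowerSeries.constantCoeff L ≠ 0 →
    Finite ↥(W.selmerGroupPInfty p) ∧
      (padicValNat p (Nat.card ↥(W.selmerGroupPInfty p)) : ℤ) +
          padicValRat p ((W.tamagawaProduct : ℚ) / (W.torsionOrder : ℚ) ^ 2) =
        ((PowerSeries.constantCoeff L : ℤ_[p]) : ℚ_[p]).valuation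

/-! ## §4 Bookkeeping -/

section Bookkeeping

variable {W : WeierstrassCurve ℚ} [W.IsElliptic] [W.IsGloballyMinimal] {p : ℕ} [Fact p.Prime]
  {V : WeierstrassCurve ℚ} [V.IsElliptic] [V.IsGloballyMinimal] {C : VariableChange ℚ}
  {N : ℕ} [NeZero N] {f : CuspForm (Gamma0 N) 2}

/-- (T-e2-r0) at a pair gives the finiteness of `Sel_{p^∞}(W/ℚ)` (hence of `Ш(W)[p^∞]`, and
`W(ℚ) ⊗ ℚ_p/ℤ_p = 0`) from (C1_η) and `L_p⁺(V, η, 0) ≠ 0` alone — no Kolyvagin input. Modus ponens;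
CONDITIONAL on the typed input. [cite: Kobayashi2003, Thm. 9.3 (p. 26)] [cite: GreenbergLNM1716, §4 Thm. 4.1] -/
theorem QuadraticBranchEvenExactControlOfPlusMCAt.finite_selmerGroupPInfty
    (h : QuadraticBranchEvenExactControlOfPlusMCAt W p) (hp5 : 5 ≤ p)
    (hC : C • W.quadraticTwist ((-1) ^ (p / 2) * p) = V) (hgood : V.HasGoodReductionAtPrime p)
    (hap : V.frobeniusTrace p = 0) (h1 : QuadraticBranchPlusMainConjectureAt V p)
    (hf : IsNewformOf V f) {ϖ : ℚ}
    (hϖ : if Even (p / 2) then (ϖ : ℝ) * V.realPeriodRat = plusPeriod f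
      else (ϖ : ℝ) * V.imaginaryPeriodRat = minusPeriod f)
    {L : IwasawaAlgebra p} (hL : IsQuadraticBranchPlusLFunction f p ϖ L)
    (h0 : PowerSeries.constantCoeff L ≠ 0) :
    Finite ↥(W.selmerGroupPInfty p) :=
  (h V C hp5 hC hgood hap h1 hf ϖ hϖ L hL h0).1

/-- (T-e2-r0) at a pair, the identity. [cite: Kobayashi2003, Thm. 9.3 (p. 26), (3.6) (p. 7)]
[cite: GreenbergLNM1716, §4 Thm. 4.1] -/
theorem QuadraticBranchEvenExactControlOfPlusMCAt.padicValNat_card_add_eq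
    (h : QuadraticBranchEvenExactControlOfPlusMCAt W p) (hp5 : 5 ≤ p)
    (hC : C • W.quadraticTwist ((-1) ^ (p / 2) * p) = V) (hgood : V.HasGoodReductionAtPrime p)
    (hap : V.frobeniusTrace p = 0) (h1 : QuadraticBranchPlusMainConjectureAt V p)
    (hf : IsNewformOf V f) {ϖ : ℚ}
    (hϖ : if Even (p / 2) then (ϖ : ℝ) * V.realPeriodRat = plusPeriod f
      else (ϖ : ℝ) * V.imaginaryPeriodRat = minusPeriod f)
    {L : IwasawaAlgebra p} (hL : IsQuadraticBranchPlusLFunction f p ϖ L)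
    (h0 : PowerSeries.constantCoeff L ≠ 0) :
    (padicValNat p (Nat.card ↥(W.selmerGroupPInfty p)) : ℤ) +
        padicValRat p ((W.tamagawaProduct : ℚ) / (W.torsionOrder : ℚ) ^ 2) =
      ((PowerSeries.constantCoeff L : ℤ_[p]) : ℚ_[p]).valuation :=
  (h V C hp5 hC hgood hap h1 hf ϖ hϖ L hL h0).2

end Bookkeeping

end Summit.BirchSwinnertonDyer.Rank1Residual.Additive

end
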